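/-
Copyright (c) 2026. All rights reserved.
Released under Apache 2.0 license as described in the file LICENSE.
-/
import Literature.MathematicalPhysics.QuantumLattice.HubbardSpinReflectionSignRule
import Summits.HubbardSuperconductivity.HubbardLadder.HubbardMomentRows
import HarnessLib

/-!
# R2 rows: a certified FLOOR — hence a two-sided bracket — on the staggered magnetisation `m_s²`
# of the half-filled `4 × 4` Hubbard torus (`U = 2, 4, 6, 8`)

HONEST FRAMING: ladder R1–R4 with certified numbers; no claim on H/H₀.
Cell `pub-hubbard`, seat r2 (observable brackets), R2-TABLE rows B1/B2 (observable `m_s²`), device D8.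

Object (OBSERVABLES.md §3; conventions of LeBlanc et al. PRX 5 (2015) 041041 §II and Qin–Shi–Zhang
PRB 94 (2016) 085103 §IV, as in `HubbardMomentRows`): for a normalised ground state `ψ` of
`H(t = 1, U)` on the `4 × 4` torus in the half-filled sector `N = 16`, the SQUARED STAGGERED
MAGNETISATION `m_s² = (1/16²) Σ_{x,y} ε_x ε_y ⟨ψ, 𝐒_x·𝐒_y ψ⟩ = ⟨ψ, 𝓢 ψ⟩/256` (`𝓢 = stagStructureFour`,
`ε_x = (-1)^{x₁+x₂}`; `= S(π,π)/16`), and the LOCAL MOMENT `m_loc = ⟨ψ, M ψ⟩/16 = 1 - 2d`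
(`M = localMomentFour = Σ_x (n_{x↑} - n_{x↓})²`).

## Method (kernel ∘ certificate; no new numerics, 0 core-h)

KERNEL (tree, `Literature/…/HubbardSpinReflectionSignRule`, on top of Lieb's spin-reflection
positivity `Literature/…/GroundStateSpinReflectionPositivityHubbard` and the uniqueness of the
half-filled ground state `Literature/…/HubbardHalfFilledGroundState{,Torus}`): for THE ground state of
the half-filled repulsive Hubbard model on a balanced connected bipartite graph,
(i) the Shen–Qiu–Tian sign rule `ε_x ε_y ⟨S⁺_x S⁻_y⟩ ≥ 0`, (ii) SU(2) isotropy on the singlet ground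
state `⟨𝐒_x·𝐒_y⟩ = (3/2)⟨S⁺_x S⁻_y⟩`, (iii) `𝓢 = 2𝐒_A² + 2𝐒_B² - 𝐒_tot²` with `𝐒_tot² ψ = 0`, and
(iv) `𝐒_x·𝐒_x = ¾ m_x` give the NÉEL-SUM FLOOR `(3/2) ⟨M⟩ ≤ ⟨𝓢⟩`, i.e. on the `4 × 4` torus
`m_s² ≥ (3/32) m_loc = (3/32)(1 - 2d)` (`three_halves_localMomentFour_le_stagStructureFour`).
This supersedes the remark in `HubbardMomentRows` that no solver-free floor on `m_s²` is available for
lattice fermions: spin-REFLECTION positivity (not spatial reflection positivity) provides one, for the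
ground state at half filling.
CERTIFICATES: exactly the hypotheses of the landed rows `HubbardDoubleOccRows.doubleOcc_four_U{2,4,6,8}
_mem_Icc_of_groundEnergy_le` (ONE ED-tight exact-rational Rayleigh upper bound `E_16(U) ≤ R`, pub-mbboot
E2 `upper_torus4x4_t1_U{2,4,6,8}_N16_s8_8`) and `HubbardMomentRows.localMoment_four_U{2,4,6,8}_mem_Icc`
(plus the lineage's certified SDP lower bounds `cert_hub_torus4x4_U{2,4,6,12}_N16_b4eom_pol` at the
neighbouring couplings) — INHERITED certificates cited by name, not re-verified here.

Rows (decimals rounded OUTWARD; floors `(3/32)·(lower bound on m_loc)` rounded DOWN; the ceilings are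
the landed `HubbardMomentRows.stagMagSq_four_U*_le_of_bounds`):
| `U` | `m_s² ≥` (∘ 1 upper cert) | `m_s² ≥` (∘ upper + SDP lower certs) | two-sided `m_s² ∈` (∘ upper + SDP lower certs) |
|-----|---------------------------|---------------------------------------|--------------------------------------------------|
| 2   | `0.0586`                  | `0.0586`                              | `[0.0586, 0.2349]`                               |
| 4   | `0.0633`                  | `0.0670`                              | `[0.0670, 0.2636]`                               |
| 6   | `0.0677`                  | `0.0733`                              | `[0.0733, 0.2830]`                               |
| 8   | `0.0721`                  | `0.0782`                              | `[0.0782, 0.2926]`                               |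
Width: the floor is the DIAGONAL (`Σ_x ⟨𝐒_x·𝐒_x⟩`-type) part of the Néel sum, `O(1/L²)` of the
ceiling — it certifies the sign structure (all `256` staggered correlations `ε_xε_y⟨𝐒_x·𝐒_y⟩ ≥ 0`),
not long-range order. For orientation only (different objects, uncertified): the Heisenberg
(`U → ∞`) `4 × 4` value `m_s² = 0.2765` (certified bracket `[0.1637, 0.3125]`, `NeelOrderParamCeiling`);
no certified or page-confirmed ground-state `m_s²` of the `4 × 4` Hubbard torus is claimed as comparator.

## References
* S.-Q. Shen, Z.-M. Qiu, G.-S. Tian, Phys. Rev. Lett. 72 (1994) 1280 (the sign rule).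
  [cite: ShenQiuTian1994, Theorem and eqs. (7)–(9)]
* G.-S. Tian, J. Stat. Phys. 116 (2004) 629, §3. [cite: Tian2004, §3]
* E. H. Lieb, Phys. Rev. Lett. 62 (1989) 1201, Theorem 2. [cite: LiebPRL1989, Theorem 2]
* J. E. Hirsch, Phys. Rev. B 31 (1985) 4403, eq. (4.7) and Table II (the observables).
  [cite: HirschPRB1985, eq. (4.7)]
-/

noncomputable section

namespace Summit.HubbardSuperconductivity.HubbardLadder

open Literature.MathematicalPhysics.QuantumLattice Literature.Probability.LatticeModels
open FermionSpinMoment Matrix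

/-! ### The kernel on the `4 × 4` torus -/

/-- The even sublattice of the `4 × 4` torus is the `+1` class of the staggering sign
`torusStagger x = (-1)^{x₁+x₂}`. [cite: LiebPRL1989, Theorem 2] -/
theorem evenSitesFour_eq_filter_torusStagger :
    evenSitesFour = Finset.univ.filter fun z : FermionTorus 2 4 => torusStagger z = 1 := by
  ext x
  simp only [evenSitesFour, Finset.mem_filter, Finset.mem_univ, true_and, torusStagger,
    Fin.sum_univ_two]
  exact (neg_one_pow_eq_one_iff_even (by decide)).symm

/-- `𝓢 = stagSpinStructure {ε = +1}`. [cite: HirschPRB1985, eq. (4.7)] -/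
theorem stagStructureFour_eq_stagSpinStructure_torusStagger :
    stagStructureFour =
      stagSpinStructure (Finset.univ.filter fun z : FermionTorus 2 4 => torusStagger z = 1) := by
  rw [stagStructureFour, evenSitesFour_eq_filter_torusStagger]

/-- **The Néel-sum floor on the `4 × 4` torus (kernel).** For every ground state `ψ` of
`H(1, U)`, `U > 0`, in the half-filled sector `N = 16`: `(3/2) ⟨ψ, M ψ⟩ ≤ ⟨ψ, 𝓢 ψ⟩`, i.e.
`m_s² ≥ (3/32) m_loc` in a unit vector. [cite: ShenQiuTian1994, Theorem and eqs. (7)–(9)] -/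
theorem three_halves_localMomentFour_le_stagStructureFour {U : ℝ} (hU : 0 < U)
    {ψ : Fock (Orb (FermionTorus 2 4))} (hψ : IsGroundState (hamiltonian (fermionTorusGraph 2 4) 1 U) 16 ψ) :
    (3 / 2 : ℝ) * (expect localMomentFour ψ).re ≤ (expect stagStructureFour ψ).re := by
  have hψ' : IsGroundState (hamiltonian (fermionTorusGraph 2 4) 1 U) (4 ^ 2) ψ := by
    simpa using hψ
  have h := hubbardTorus_three_halves_localMoment_le_stagSpinStructure_of_isGroundState (L := 4)
    (by decide) one_ne_zero hU hψ'
  rw [stagStructureFour_eq_stagSpinStructure_torusStagger]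
  exact h

/-- **All staggered spin correlations of the half-filled `4 × 4` ground state are non-negative**:
`(-1)^{x₁+x₂+y₁+y₂} Re ⟨ψ, S⁺_x S⁻_y ψ⟩ ≥ 0` for all `x, y` (the Shen–Qiu–Tian sign rule).
[cite: ShenQiuTian1994, Theorem and eqs. (7)–(9)] -/
theorem stagSign_spinPlusMinus_four_nonneg {U : ℝ} (hU : 0 < U)
    {ψ : Fock (Orb (FermionTorus 2 4))} (hψ : IsGroundState (hamiltonian (fermionTorusGraph 2 4) 1 U) 16 ψ)
    (x y : FermionTorus 2 4) :
    0 ≤ ((-1 : ℂ) ^ ((ofLex x 0).val + (ofLex x 1).val) * (-1 : ℂ) ^ ((ofLex y 0).val + (ofLex y 1).val) *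
      expect (fermionSpinPlus x * fermionSpinMinus y) ψ).re := by
  have hψ' : IsGroundState (hamiltonian (fermionTorusGraph 2 4) 1 U) (4 ^ 2) ψ := by
    simpa using hψ
  have h := hubbardTorus_shenQiuTian_sign_rule (L := 4) (by decide) one_ne_zero hU hψ'.1 hψ'.2.2 x y
  rw [← evenSitesFour_eq_filter_torusStagger, stagSign_evenSitesFour, stagSign_evenSitesFour] at h
  exact h

/-! ### Rows: the floor on `m_s² = ⟨𝓢⟩/256` ∘ ONE Rayleigh certificate -/

/-- **R2 row B.S⁻ at `U = 2` (kernel ∘ 1 certificate).** `m_s² ≥ 0.0586` if `E_16(2) ≤ -18.0175711`.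
[cite: ShenQiuTian1994, Theorem and eqs. (7)–(9)] -/
theorem stagMagSq_four_U2_ge_of_groundEnergy_le {ψ : Fock (Orb (FermionTorus 2 4))}
    (hψ : IsGroundState (hamiltonian (fermionTorusGraph 2 4) 1 2) 16 ψ) (hψ1 : star ψ ⬝ᵥ ψ = 1)
    (hR : groundEnergyAt (fermionTorusGraph 2 4) 1 2 16 ≤ -18.0175711) :
    (0.0586 : ℝ) ≤ (expect stagStructureFour ψ).re / 256 := by
  have hd := (doubleOcc_four_U2_mem_Icc_of_groundEnergy_le hψ hψ1 hR).2
  have hm := re_expect_localMomentFour hψ.1 hψ1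
  have hk := three_halves_localMomentFour_le_stagStructureFour (by norm_num) hψ
  push_cast at hm
  rw [hm] at hk
  rw [le_div_iff₀ (by norm_num)]
  linarith

/-- **R2 row B1.S⁻ at `U = 4` (kernel ∘ 1 certificate).** `m_s² ≥ 0.0633` if `E_16(4) ≤ -13.6218519`.
[cite: ShenQiuTian1994, Theorem and eqs. (7)–(9)] -/
theorem stagMagSq_four_U4_ge_of_groundEnergy_le {ψ : Fock (Orb (FermionTorus 2 4))}
    (hψ : IsGroundState (hamiltonian (fermionTorusGraph 2 4) 1 4) 16 ψ) (hψ1 : star ψ ⬝ᵥ ψ = 1)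
    (hR : groundEnergyAt (fermionTorusGraph 2 4) 1 4 16 ≤ -13.6218519) :
    (0.0633 : ℝ) ≤ (expect stagStructureFour ψ).re / 256 := by
  have hd := (doubleOcc_four_U4_mem_Icc_of_groundEnergy_le hψ hψ1 hR).2
  have hm := re_expect_localMomentFour hψ.1 hψ1
  have hk := three_halves_localMomentFour_le_stagStructureFour (by norm_num) hψ
  push_cast at hm
  rw [hm] at hk
  rw [le_div_iff₀ (by norm_num)]
  linarith

/-- **R2 row B.S⁻ at `U = 6` (kernel ∘ 1 certificate).** `m_s² ≥ 0.0677` if `E_16(6) ≤ -10.5521941`.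
[cite: ShenQiuTian1994, Theorem and eqs. (7)–(9)] -/
theorem stagMagSq_four_U6_ge_of_groundEnergy_le {ψ : Fock (Orb (FermionTorus 2 4))}
    (hψ : IsGroundState (hamiltonian (fermionTorusGraph 2 4) 1 6) 16 ψ) (hψ1 : star ψ ⬝ᵥ ψ = 1)
    (hR : groundEnergyAt (fermionTorusGraph 2 4) 1 6 16 ≤ -10.5521941) :
    (0.0677 : ℝ) ≤ (expect stagStructureFour ψ).re / 256 := by
  have hd := (doubleOcc_four_U6_mem_Icc_of_groundEnergy_le hψ hψ1 hR).2
  have hm := re_expect_localMomentFour hψ.1 hψ1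
  have hk := three_halves_localMomentFour_le_stagStructureFour (by norm_num) hψ
  push_cast at hm
  rw [hm] at hk
  rw [le_div_iff₀ (by norm_num)]
  linarith

/-- **R2 row B2.S⁻ at `U = 8` (kernel ∘ 1 certificate).** `m_s² ≥ 0.0721` if `E_16(8) ≤ -8.4688588`.
[cite: ShenQiuTian1994, Theorem and eqs. (7)–(9)] -/
theorem stagMagSq_four_U8_ge_of_groundEnergy_le {ψ : Fock (Orb (FermionTorus 2 4))}
    (hψ : IsGroundState (hamiltonian (fermionTorusGraph 2 4) 1 8) 16 ψ) (hψ1 : star ψ ⬝ᵥ ψ = 1)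
    (hR : groundEnergyAt (fermionTorusGraph 2 4) 1 8 16 ≤ -8.4688588) :
    (0.0721 : ℝ) ≤ (expect stagStructureFour ψ).re / 256 := by
  have hd := (doubleOcc_four_U8_mem_Icc_of_groundEnergy_le hψ hψ1 hR).2
  have hm := re_expect_localMomentFour hψ.1 hψ1
  have hk := three_halves_localMomentFour_le_stagStructureFour (by norm_num) hψ
  push_cast at hm
  rw [hm] at hk
  rw [le_div_iff₀ (by norm_num)]
  linarith

/-! ### Rows: the floor and the two-sided bracket on `m_s²` ∘ upper + SDP lower certificates -/

/-- **R2 row B.S∓ at `U = 2` (kernel ∘ 2 certificates).** `m_s² ∈ [0.0586, 0.2349]`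
(floor: this file; ceiling: `stagMagSq_four_U2_le_of_bounds`). [cite: ShenQiuTian1994, Theorem and eqs. (7)–(9)] -/
theorem stagMagSq_four_U2_mem_Icc_of_bounds {ψ : Fock (Orb (FermionTorus 2 4))}
    (hψ : IsGroundState (hamiltonian (fermionTorusGraph 2 4) 1 2) 16 ψ) (hψ1 : star ψ ⬝ᵥ ψ = 1)
    (hR : groundEnergyAt (fermionTorusGraph 2 4) 1 2 16 ≤ -18.0175711)
    (hL₂ : (-14.0382299 : ℝ) ≤ groundEnergyAt (fermionTorusGraph 2 4) 1 4 16) :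
    (expect stagStructureFour ψ).re / 256 ∈ Set.Icc (0.0586 : ℝ) 0.2349 := by
  refine ⟨?_, stagMagSq_four_U2_le_of_bounds hψ hψ1 hR hL₂⟩
  have hm := (localMoment_four_U2_mem_Icc hψ hψ1 hR hL₂).1
  have hk := three_halves_localMomentFour_le_stagStructureFour (by norm_num) hψ
  rw [le_div_iff₀ (by norm_num)] at hm ⊢
  linarith

/-- **R2 row B1.S∓ at `U = 4` (kernel ∘ 3 certificates).** `m_s² ∈ [0.0670, 0.2636]`
(floor: this file; ceiling: `stagMagSq_four_U4_le_of_bounds`). [cite: ShenQiuTian1994, Theorem and eqs. (7)–(9)] -/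
theorem stagMagSq_four_U4_mem_Icc_of_bounds {ψ : Fock (Orb (FermionTorus 2 4))}
    (hψ : IsGroundState (hamiltonian (fermionTorusGraph 2 4) 1 4) 16 ψ) (hψ1 : star ψ ⬝ᵥ ψ = 1)
    (hL₁ : (-18.1702781 : ℝ) ≤ groundEnergyAt (fermionTorusGraph 2 4) 1 2 16)
    (hR : groundEnergyAt (fermionTorusGraph 2 4) 1 4 16 ≤ -13.6218519)
    (hL₂ : (-11.1131766 : ℝ) ≤ groundEnergyAt (fermionTorusGraph 2 4) 1 6 16) :
    (expect stagStructureFour ψ).re / 256 ∈ Set.Icc (0.0670 : ℝ) 0.2636 := by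
  refine ⟨?_, stagMagSq_four_U4_le_of_bounds hψ hψ1 hL₁ hR hL₂⟩
  have hm := (localMoment_four_U4_mem_Icc hψ hψ1 hL₁ hR hL₂).1
  have hk := three_halves_localMomentFour_le_stagStructureFour (by norm_num) hψ
  rw [le_div_iff₀ (by norm_num)] at hm ⊢
  linarith

/-- **R2 row B.S∓ at `U = 6` (kernel ∘ 3 certificates).** `m_s² ∈ [0.0733, 0.2830]`
(floor: this file; ceiling: `stagMagSq_four_U6_le_of_bounds`). [cite: ShenQiuTian1994, Theorem and eqs. (7)–(9)] -/
theorem stagMagSq_four_U6_mem_Icc_of_bounds {ψ : Fock (Orb (FermionTorus 2 4))}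
    (hψ : IsGroundState (hamiltonian (fermionTorusGraph 2 4) 1 6) 16 ψ) (hψ1 : star ψ ⬝ᵥ ψ = 1)
    (hL₁ : (-14.0382299 : ℝ) ≤ groundEnergyAt (fermionTorusGraph 2 4) 1 4 16)
    (hR : groundEnergyAt (fermionTorusGraph 2 4) 1 6 16 ≤ -10.5521941)
    (hL₂ : (-9.0396662 : ℝ) ≤ groundEnergyAt (fermionTorusGraph 2 4) 1 8 16) :
    (expect stagStructureFour ψ).re / 256 ∈ Set.Icc (0.0733 : ℝ) 0.2830 := by
  refine ⟨?_, stagMagSq_four_U6_le_of_bounds hψ hψ1 hL₁ hR hL₂⟩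
  have hm := (localMoment_four_U6_mem_Icc hψ hψ1 hL₁ hR hL₂).1
  have hk := three_halves_localMomentFour_le_stagStructureFour (by norm_num) hψ
  rw [le_div_iff₀ (by norm_num)] at hm ⊢
  linarith

/-- **R2 row B2.S∓ at `U = 8` (kernel ∘ 3 certificates).** `m_s² ∈ [0.0782, 0.2926]`
(floor: this file; ceiling: `stagMagSq_four_U8_le_of_bounds`). [cite: ShenQiuTian1994, Theorem and eqs. (7)–(9)] -/
theorem stagMagSq_four_U8_mem_Icc_of_bounds {ψ : Fock (Orb (FermionTorus 2 4))}
    (hψ : IsGroundState (hamiltonian (fermionTorusGraph 2 4) 1 8) 16 ψ) (hψ1 : star ψ ⬝ᵥ ψ = 1)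
    (hL₁ : (-11.1131766 : ℝ) ≤ groundEnergyAt (fermionTorusGraph 2 4) 1 6 16)
    (hR : groundEnergyAt (fermionTorusGraph 2 4) 1 8 16 ≤ -8.4688588)
    (hL₂ : (-6.4248475 : ℝ) ≤ groundEnergyAt (fermionTorusGraph 2 4) 1 12 16) :
    (expect stagStructureFour ψ).re / 256 ∈ Set.Icc (0.0782 : ℝ) 0.2926 := by
  refine ⟨?_, stagMagSq_four_U8_le_of_bounds hψ hψ1 hL₁ hR hL₂⟩
  have hm := (localMoment_four_U8_mem_Icc hψ hψ1 hL₁ hR hL₂).1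
  have hk := three_halves_localMomentFour_le_stagStructureFour (by norm_num) hψ
  rw [le_div_iff₀ (by norm_num)] at hm ⊢
  linarith

end Summit.HubbardSuperconductivity.HubbardLadder
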